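import Literature.AlgebraicTopology.SingularHomology.CupRightAction
import Literature.AlgebraicTopology.SingularHomology.CechDualityMayerVietoris
import HarnessLib

/-!
# The Mayer–Vietoris coboundary in cohomology is linear over cup products with global classes

Topic `Literature/AlgebraicTopology/SingularHomology`. D. Husemoller, *Fibre Bundles*, Ch. 17 §1,
proof of the Leray–Hirsch theorem 1.1: the comparison map `θ_U (Σᵢ cᵢ xᵢ) = Σᵢ p*(cᵢ) aᵢ` from
the direct sum `K(U) = Σᵢ H^{n-n(i)}(U) xᵢ` to `L(U) = Hⁿ(E_U)` is a morphism of Mayer–Vietoris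
sequences ("we have the following commutative diagram with exact rows"), which for the connecting
maps is the statement that **the Mayer–Vietoris coboundary commutes with the cup product by the
fixed global classes `aᵢ`**: `δ(α ⌣ a) = δ(α) ⌣ a` (A. Hatcher, *Algebraic Topology* (2002),
§3.1 p. 204 for the sequence, Lemma 3.6 / §3.2 p. 209 for the module structure over `H*(X)`).

For the tree's cohomology of open subsets computed in `C(X)` (`subsetCochains R 𝑹 W`,
`H^p_X(W)`, Mayer–Vietoris `subsetCochains.mvδ`) and the right action `⌣ β` of a global cocycle
`β ∈ Zᵈ(X; R)` on the cochains of simplex spans (`CupRightAction.lean`) we PROVE: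

* `SimplexSpan.cupRightH 𝒮 hS β hβ h : Hᵖ(Hom(𝒮, 𝑹)) →ₗ[R] Hⁿ(Hom(𝒮, 𝑹))` (`p + d = n`) — the
  action on cohomology, `[ψ] ↦ [ψ ⌣ β]` (`cupRightH_homologyCls`), for every front/back-closed
  span (`C(W)`, `C(A) + C(B)`), and its naturality under restriction of spans
  (`homologyMap_dualMap_cupRightH`);
* `subsetCochains.shortExact_δ_cls_cupRight` — the Mayer–Vietoris connecting map on the
  representative `f ⌣ β` is the class of `snakeCochain f ⌣ β` (Mathlib's
  `ShortComplex.ShortExact.δ_apply` with the lift `extendLeft f ⌣ β`);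
* `subsetCochains.mvδ_cupRightH` — **`δ(α ⌣ β) = δ(α) ⌣ β`** for the connecting map
  `δ : H^p_X(W ∩ Y) → H^{p+1}_X(W ∪ Y)` of an open pair `W`, `Y` and every global cocycle `β`.

Everything is proved; no named facts.

## References

* [HusemollerFibreBundles1994] D. Husemoller, *Fibre Bundles*, 3rd ed. (1994), Ch. 17 §1,
  Thm. 1.1 (proof).
* [HatcherAT2002] A. Hatcher, *Algebraic Topology*, CUP 2002, §3.1 p. 204, Lemma 3.6, §3.2 p. 209.
-/

noncomputable section

-- as in `CechCapProduct` / `CechDualityMayerVietoris`: chains of the concrete complex are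
-- `Finsupp`s up to unfolding of semireducible definitions
set_option backward.isDefEq.respectTransparency false

open CategoryTheory Limits

universe u v

namespace Literature.AlgebraicTopology.SingularHomology

/-! ### Classes of coboundaries vanish (cochain complexes of shape `(down ℕ).symm`) -/

/-- The class of a coboundary is zero, for complexes of the cochain shape `(down ℕ).symm` of the
tree's `subsetCochains`. [folklore] -/
theorem homologyCls_d_eq_zero_symm {R : Type v} [CommRing R]
    {K : HomologicalComplex (ModuleCat.{max u v} R) (ComplexShape.down ℕ).symm}
    (j : ℕ) (w : K.X j)
    (h : K.d (j + 1) ((ComplexShape.down ℕ).symm.next (j + 1)) (K.d j (j + 1) w) = 0) :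
    homologyCls (K.d j (j + 1) w) h = 0 := by
  rw [homologyCls_eq_zero_iff]
  have hp : (ComplexShape.down ℕ).symm.prev (j + 1) = j := SimplexSpan.symm_down_prev_succ j
  refine ⟨(K.XIsoOfEq hp).inv w, ?_⟩
  rw [← ModuleCat.comp_apply, K.XIsoOfEq_inv_comp_d hp]

namespace SimplexSpan

variable {R : Type v} [CommRing R] {X : Type u} [TopologicalSpace X]

/-- Local notation: the coefficient object `R` of `ModuleCat.{max u v} R`. -/
local notation "𝑹" => SimplexSpan.coefR R

variable (𝒮 : SimplexSpan R X) (hS : 𝒮.FrontBackClosed) {d : ℕ} (β : SingularSimplex X d → R)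
  (hβ : (singularCochainComplex R R X).d d (d + 1) β = 0)

/-! ### The action of a global cocycle on the cohomology of a span -/

include hS hβ in
/-- `ψ ⌣ β` is a cocycle when `ψ` is (Leibniz, `β` a cocycle). [cite: HatcherAT2002, Lemma 3.6] -/
theorem d_cupRight_eq_zero {p n : ℕ} (h : p + d = n) (ψ : 𝒮.sub.toComplex.X p ⟶ 𝑹)
    (hψ : 𝒮.cochains.d p (p + 1) ψ = 0) : 𝒮.cochains.d n (n + 1) (𝒮.cupRight β h ψ) = 0 := by
  rw [𝒮.d_cupRight hS β hβ h ψ, hψ]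
  exact (𝒮.cupRightₗ β _).map_zero

include hS hβ in
/-- The same in the `next`-form of the cocycle condition. [folklore] -/
theorem d_next_cupRight_eq_zero {p n : ℕ} (h : p + d = n) (ψ : 𝒮.sub.toComplex.X p ⟶ 𝑹)
    (hψ : 𝒮.cochains.d p ((ComplexShape.down ℕ).symm.next p) ψ = 0) :
    𝒮.cochains.d n ((ComplexShape.down ℕ).symm.next n) (𝒮.cupRight β h ψ) = 0 :=
  (d_next_eq_zero_iff (symm_down_next n) _).2
    (𝒮.d_cupRight_eq_zero hS β hβ h ψ ((d_next_eq_zero_iff (symm_down_next p) _).1 hψ))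

/-- `[ψ] ↦ [ψ ⌣ β]` on cocycles (kernel form). [cite: HatcherAT2002, §3.2 p. 209] -/
def cupRightKer {p n : ℕ} (h : p + d = n) :
    LinearMap.ker ((𝒮.cochains).sc p).g.hom →ₗ[R] 𝒮.cochains.homology n where
  toFun ψ := homologyCls (𝒮.cupRight β h ψ.1)
    (𝒮.d_next_cupRight_eq_zero hS β hβ h ψ.1 (LinearMap.mem_ker.1 ψ.2))
  map_add' ψ ψ' := by
    refine (homologyCls_congr (𝒮.cupRight_add β h ψ.1 ψ'.1) _ ?_).trans (homologyCls_add _ _ _ _ _)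
    rw [map_add, 𝒮.d_next_cupRight_eq_zero hS β hβ h ψ.1 (LinearMap.mem_ker.1 ψ.2),
      𝒮.d_next_cupRight_eq_zero hS β hβ h ψ'.1 (LinearMap.mem_ker.1 ψ'.2), add_zero]
  map_smul' r ψ := by
    refine (homologyCls_congr (𝒮.cupRight_smul β h r ψ.1) _ ?_).trans (homologyCls_smul _ _ _ _)
    rw [map_smul, 𝒮.d_next_cupRight_eq_zero hS β hβ h ψ.1 (LinearMap.mem_ker.1 ψ.2), smul_zero]

/-- `cupRightKer` on a cocycle is the class of its cup product. [folklore] -/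
theorem cupRightKer_apply {p n : ℕ} (h : p + d = n) (ψ : LinearMap.ker ((𝒮.cochains).sc p).g.hom) :
    𝒮.cupRightKer hS β hβ h ψ = homologyCls (𝒮.cupRight β h ψ.1)
      (𝒮.d_next_cupRight_eq_zero hS β hβ h ψ.1 (LinearMap.mem_ker.1 ψ.2)) := rfl

/-- `cupRightKer` kills coboundaries: `[δw ⌣ β] = [δ(w ⌣ β)] = 0`. [cite: HatcherAT2002, Lemma 3.6] -/
theorem cupRightKer_d {p n : ℕ} (h : p + d = n) (j : ℕ) (w : 𝒮.cochains.X j) :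
    𝒮.cupRightKer hS β hβ h ⟨𝒮.cochains.d j p w, d_mem_ker j w⟩ = 0 := by
  by_cases hj : (ComplexShape.down ℕ).symm.Rel j p
  · obtain rfl : j + 1 = p := hj
    obtain rfl : n = (j + d) + 1 := by omega
    rw [cupRightKer_apply]
    have e : 𝒮.cupRight β h (𝒮.cochains.d j (j + 1) w) =
        𝒮.cochains.d (j + d) (j + d + 1) (𝒮.cupRight β rfl w) := (𝒮.d_cupRight hS β hβ rfl w).symm
    have hd2 : 𝒮.cochains.d (j + d + 1) ((ComplexShape.down ℕ).symm.next (j + d + 1))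
        (𝒮.cochains.d (j + d) (j + d + 1) (𝒮.cupRight β rfl w)) = 0 := by
      rw [← ModuleCat.comp_apply, HomologicalComplex.d_comp_d]
      rfl
    exact (homologyCls_congr e _ hd2).trans (homologyCls_d_eq_zero_symm (j + d) _ hd2)
  · have e : (⟨𝒮.cochains.d j p w, d_mem_ker j w⟩ : LinearMap.ker ((𝒮.cochains).sc p).g.hom) = 0 := by
      apply Subtype.ext
      change 𝒮.cochains.d j p w = 0
      rw [𝒮.cochains.shape j p hj]
      rfl
    rw [e, map_zero]

/-- **The action `⌣ β : Hᵖ(Hom(𝒮, 𝑹)) → Hⁿ(Hom(𝒮, 𝑹))` of a global cocycle `β` on the cohomology of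
a front/back-closed simplex span** (`p + d = n`; Hatcher 2002, §3.2 p. 209: the `H*(X)`-module
structure). [cite: HatcherAT2002, §3.2 p. 209] -/
def cupRightH {p n : ℕ} (h : p + d = n) : 𝒮.cochains.homology p →ₗ[R] 𝒮.cochains.homology n :=
  homologyDescKer (𝒮.cupRightKer hS β hβ h) fun w ↦ 𝒮.cupRightKer_d hS β hβ h _ w

/-- `[ψ] ⌣ β = [ψ ⌣ β]`. [cite: HatcherAT2002, §3.2 p. 209] -/
theorem cupRightH_homologyCls {p n : ℕ} (h : p + d = n) (ψ : 𝒮.cochains.X p)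
    (hψ : 𝒮.cochains.d p ((ComplexShape.down ℕ).symm.next p) ψ = 0) :
    𝒮.cupRightH hS β hβ h (homologyCls ψ hψ) =
      homologyCls (𝒮.cupRight β h ψ) (𝒮.d_next_cupRight_eq_zero hS β hβ h ψ hψ) := by
  rw [cupRightH, homologyDescKer_homologyCls]
  rfl

/-- **Naturality of `⌣ β` under restriction of spans**: for front/back-closed `𝒮' ≤ 𝒮`, restricting
to `Hom(𝒮', 𝑹)` commutes with `⌣ β` on cohomology. [cite: HatcherAT2002, §3.2 Prop. 3.10] -/
theorem homologyMap_dualMap_cupRightH (𝒮' : SimplexSpan R X) (hle : 𝒮'.sub ≤ 𝒮.sub)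
    (hS' : 𝒮'.FrontBackClosed)
    (hmem : ∀ {k} {σ : SingularSimplex X k}, σ ∈ 𝒮'.carrier k → σ ∈ 𝒮.carrier k)
    {p n : ℕ} (h : p + d = n) (x : 𝒮.cochains.homology p) :
    HomologicalComplex.homologyMap (dualMap R 𝑹 (Subcomplex.incl hle)) n (𝒮.cupRightH hS β hβ h x) =
      𝒮'.cupRightH hS' β hβ h (HomologicalComplex.homologyMap (dualMap R 𝑹 (Subcomplex.incl hle)) p x) := by
  obtain ⟨ψ, hψ, rfl⟩ := homologyCls_surjective x
  rw [𝒮.cupRightH_homologyCls hS β hβ h ψ hψ, homologyMap_homologyCls, homologyMap_homologyCls,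
    𝒮'.cupRightH_homologyCls hS' β hβ h]
  refine homologyCls_congr ?_ _ _
  rw [dualMap_f_apply, dualMap_f_apply]
  exact 𝒮.incl_cupRight 𝒮' hle hS' hmem β h ψ

end SimplexSpan

/-! ### Mayer–Vietoris: `δ(α ⌣ β) = δ(α) ⌣ β` -/

namespace subsetCochains

variable {R : Type v} [CommRing R] {X : Type u} [TopologicalSpace X]

/-- Local notation: the coefficient object `R` of `ModuleCat.{max u v} R`. -/
local notation "𝑹" => SimplexSpan.coefR R

variable {W Y : Set X} {p d n : ℕ} (β : SingularSimplex X d → R)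
  (hβ : (singularCochainComplex R R X).d d (d + 1) β = 0)

/-- Carrier inclusion `C(W ∩ Y) ⊆ C(W)` on simplices. [folklore] -/
lemma mem_ofSet_of_mem_ofSet_inter {k : ℕ} {σ : SingularSimplex X k}
    (h : σ ∈ (SimplexSpan.ofSet (R := R) (W ∩ Y)).carrier k) : σ ∈ (SimplexSpan.ofSet (R := R) W).carrier k :=
  fun _ hx ↦ (h hx).1

/-- **Restriction to `W ∩ Y` commutes with `⌣ β` on cochains of `W`.** [folklore] -/
theorem res_cupRight (h : p + d = n) (ψ : (subsetCochains R 𝑹 W).X p) :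
    (res R 𝑹 (Set.inter_subset_left : W ∩ Y ⊆ W)).f n
        ((SimplexSpan.ofSet (R := R) W).cupRight β h ψ) =
      (SimplexSpan.ofSet (R := R) (W ∩ Y)).cupRight β h
        ((res R 𝑹 (Set.inter_subset_left : W ∩ Y ⊆ W)).f p ψ) := by
  rw [res_f_apply, res_f_apply]
  exact (SimplexSpan.ofSet (R := R) W).incl_cupRight (SimplexSpan.ofSet (R := R) (W ∩ Y))
    (chainsInSub_mono R R Set.inter_subset_left) (SimplexSpan.frontBackClosed_ofSet _)
    mem_ofSet_of_mem_ofSet_inter β h ψ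

/-- **The Mayer–Vietoris connecting map on the representative `f ⌣ β`** is the class of
`snakeCochain f ⌣ β` (Mathlib's `δ_apply` with the lift `extendLeft f ⌣ β`, which works by the
Leibniz rule and the compatibility of `⌣ β` with the restrictions). [cite: HatcherAT2002, §3.1 p. 204] -/
theorem shortExact_δ_cls_cupRight (f : (subsetCochains R 𝑹 (W ∩ Y)).X p)
    (hf' : (subsetCochains R 𝑹 (W ∩ Y)).d p ((ComplexShape.down ℕ).symm.next p) f = 0)
    (h : p + d = n) :
    (mvShortComplex_shortExact R 𝑹 W Y).δ n (n + 1) (crel n)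
        (homologyCls ((SimplexSpan.ofSet (R := R) (W ∩ Y)).cupRight β h f)
          ((SimplexSpan.ofSet (R := R) (W ∩ Y)).d_next_cupRight_eq_zero
            (SimplexSpan.frontBackClosed_ofSet _) β hβ h f hf')) =
      homologyCls (K := dualObj R 𝑹 (chainsInSub R R X W ⊔ chainsInSub R R X Y).toComplex)
        ((SimplexSpan.ofSets (R := R) W Y).cupRight β (show (p + 1) + d = n + 1 by omega) (snakeCochain f))
        ((SimplexSpan.ofSets (R := R) W Y).d_next_cupRight_eq_zero (SimplexSpan.frontBackClosed_ofSets _ _)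
          β hβ _ _ ((d_next_eq_zero_iff (SimplexSpan.symm_down_next (p + 1)) _).2
            (d_snakeCochain f ((d_next_eq_zero_iff (SimplexSpan.symm_down_next p) f).mp hf') _))) := by
  have hf : (subsetCochains R 𝑹 (W ∩ Y)).d p (p + 1) f = 0 :=
    (d_next_eq_zero_iff (SimplexSpan.symm_down_next p) f).mp hf'
  have h1 : (p + 1) + d = n + 1 := by omega
  -- the lift `x₂ = (extendLeft f ⌣ β, 0)` and the cochain `x₁ = snakeCochain f ⌣ β`
  let gW : (subsetCochains R 𝑹 W).X n := (SimplexSpan.ofSet (R := R) W).cupRight β h (extendLeft f)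
  let x₂ : (subsetCochains R 𝑹 W ⊞ subsetCochains R 𝑹 Y).X n :=
    (biprod.inl : _ ⟶ subsetCochains R 𝑹 W ⊞ subsetCochains R 𝑹 Y).f n gW
  let x₁ : (dualObj R 𝑹 (chainsInSub R R X W ⊔ chainsInSub R R X Y).toComplex).X (n + 1) :=
    (SimplexSpan.ofSets (R := R) W Y).cupRight β h1 (snakeCochain f)
  have hx₃ : (subsetCochains R 𝑹 (W ∩ Y)).d n (n + 1) ((SimplexSpan.ofSet (R := R) (W ∩ Y)).cupRight β h f) = 0 :=
    (SimplexSpan.ofSet (R := R) (W ∩ Y)).d_cupRight_eq_zero (SimplexSpan.frontBackClosed_ofSet _) β hβ h f hf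
  have hx₂ : (mvShortComplex R 𝑹 W Y).g.f n x₂ = (SimplexSpan.ofSet (R := R) (W ∩ Y)).cupRight β h f := by
    have e1 : (mvShortComplex R 𝑹 W Y).g.f n x₂ = (res R 𝑹 (Set.inter_subset_left : W ∩ Y ⊆ W)).f n gW := by
      change (biprod.desc (res R 𝑹 Set.inter_subset_left) (-res R 𝑹 Set.inter_subset_right)).f n
        ((biprod.inl : _ ⟶ subsetCochains R 𝑹 W ⊞ subsetCochains R 𝑹 Y).f n gW) = _
      rw [← ModuleCat.comp_apply, ← HomologicalComplex.comp_f, biprod.inl_desc]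
    rw [e1]
    exact (res_cupRight β h (extendLeft f)).trans (congrArg _ (res_extendLeft f))
  -- the components of `F(x₁)`
  have hleft : (dualMap R 𝑹 (Subcomplex.incl (le_sup_left : chainsInSub R R X W ≤
        chainsInSub R R X W ⊔ chainsInSub R R X Y))).f (n + 1) x₁ =
      (subsetCochains R 𝑹 W).d n (n + 1) gW := by
    have e1 : (dualMap R 𝑹 (Subcomplex.incl (le_sup_left : chainsInSub R R X W ≤
        chainsInSub R R X W ⊔ chainsInSub R R X Y))).f (n + 1) x₁ =
        (SimplexSpan.ofSet (R := R) W).cupRight β h1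
          ((dualMap R 𝑹 (Subcomplex.incl (le_sup_left : chainsInSub R R X W ≤
            chainsInSub R R X W ⊔ chainsInSub R R X Y))).f (p + 1) (snakeCochain f)) :=
      (SimplexSpan.ofSets (R := R) W Y).incl_cupRight (SimplexSpan.ofSet (R := R) W)
        (le_sup_left : chainsInSub R R X W ≤ chainsInSub R R X W ⊔ chainsInSub R R X Y)
        (SimplexSpan.frontBackClosed_ofSet _) (fun hσ ↦ Or.inl hσ) β h1 (snakeCochain f)
    rw [e1, dualMap_left_snakeCochain]
    exact ((SimplexSpan.ofSet (R := R) W).d_cupRight (SimplexSpan.frontBackClosed_ofSet _) β hβ h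
      (extendLeft f)).symm
  have hright : (dualMap R 𝑹 (Subcomplex.incl (le_sup_right : chainsInSub R R X Y ≤
        chainsInSub R R X W ⊔ chainsInSub R R X Y))).f (n + 1) x₁ = 0 := by
    have e1 : (dualMap R 𝑹 (Subcomplex.incl (le_sup_right : chainsInSub R R X Y ≤
        chainsInSub R R X W ⊔ chainsInSub R R X Y))).f (n + 1) x₁ =
        (SimplexSpan.ofSet (R := R) Y).cupRight β h1
          ((dualMap R 𝑹 (Subcomplex.incl (le_sup_right : chainsInSub R R X Y ≤
            chainsInSub R R X W ⊔ chainsInSub R R X Y))).f (p + 1) (snakeCochain f)) :=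
      (SimplexSpan.ofSets (R := R) W Y).incl_cupRight (SimplexSpan.ofSet (R := R) Y)
        (le_sup_right : chainsInSub R R X Y ≤ chainsInSub R R X W ⊔ chainsInSub R R X Y)
        (SimplexSpan.frontBackClosed_ofSet _) (fun hσ ↦ Or.inr hσ) β h1 (snakeCochain f)
    rw [e1, dualMap_right_snakeCochain f hf]
    exact ((SimplexSpan.ofSet (R := R) Y).cupRightₗ β _).map_zero
  have hx₁ : (mvShortComplex R 𝑹 W Y).f.f (n + 1) x₁ =
      (subsetCochains R 𝑹 W ⊞ subsetCochains R 𝑹 Y).d n (n + 1) x₂ := by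
    have hcomm : (subsetCochains R 𝑹 W ⊞ subsetCochains R 𝑹 Y).d n (n + 1) x₂ =
        (biprod.inl : _ ⟶ subsetCochains R 𝑹 W ⊞ subsetCochains R 𝑹 Y).f (n + 1)
          ((subsetCochains R 𝑹 W).d n (n + 1) gW) := by
      change (subsetCochains R 𝑹 W ⊞ subsetCochains R 𝑹 Y).d n (n + 1)
        ((biprod.inl : _ ⟶ subsetCochains R 𝑹 W ⊞ subsetCochains R 𝑹 Y).f n gW) = _
      rw [← ModuleCat.comp_apply, (biprod.inl : _ ⟶ subsetCochains R 𝑹 W ⊞ subsetCochains R 𝑹 Y).comm,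
        ModuleCat.comp_apply]
    rw [hcomm]
    change (biprod.lift (dualMap R 𝑹 (Subcomplex.incl (le_sup_left : chainsInSub R R X W ≤ _)))
      (dualMap R 𝑹 (Subcomplex.incl (le_sup_right : chainsInSub R R X Y ≤ _)))).f (n + 1) x₁ = _
    rw [biprod.lift_eq, HomologicalComplex.add_f_apply]
    change (dualMap R 𝑹 (Subcomplex.incl le_sup_left) ≫ biprod.inl).f (n + 1) x₁ +
      (dualMap R 𝑹 (Subcomplex.incl le_sup_right) ≫ biprod.inr).f (n + 1) x₁ = _
    rw [HomologicalComplex.comp_f, HomologicalComplex.comp_f, ModuleCat.comp_apply, ModuleCat.comp_apply,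
      hleft, hright, map_zero, add_zero]
  have key := (mvShortComplex_shortExact R 𝑹 W Y).δ_apply n (n + 1) (crel n)
    ((SimplexSpan.ofSet (R := R) (W ∩ Y)).cupRight β h f) hx₃ x₂ hx₂ x₁ hx₁
    ((ComplexShape.down ℕ).symm.next (n + 1)) rfl
  rw [homologyCls_eq_homologyπ_cyclesMk _ _ (n + 1) (SimplexSpan.symm_down_next n),
    homologyCls_eq_homologyπ_cyclesMk _ _ ((ComplexShape.down ℕ).symm.next (n + 1)) rfl]
  exact key

/-- Restriction to small cochains after the connecting map `mvδ` is the connecting map of the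
short exact sequence. [folklore] -/
theorem homologyMap_resSup_mvδ_eq (hW : IsOpen W) (hY : IsOpen Y) (k : ℕ)
    (y : (subsetCochains R 𝑹 (W ∩ Y)).homology k) :
    HomologicalComplex.homologyMap (resSup R 𝑹 W Y) (k + 1) (mvδ R 𝑹 hW hY k y) =
      (mvShortComplex_shortExact R 𝑹 W Y).δ k (k + 1) (crel k) y := by
  change ((mvShortComplex_shortExact R 𝑹 W Y).δ k (k + 1) (crel k) ≫
    (supHomologyIso (N := 𝑹) hW hY (k + 1)).hom ≫ (supHomologyIso (N := 𝑹) hW hY (k + 1)).inv) y = _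
  rw [Iso.hom_inv_id, Category.comp_id]

/-- **The Mayer–Vietoris coboundary is linear over the cup product with global cocycles**:
`δ(α ⌣ β) = δ(α) ⌣ β` for `δ : H^p_X(W ∩ Y) → H^{p+1}_X(W ∪ Y)` (`W`, `Y` open) and a cocycle
`β ∈ Zᵈ(X; R)` of the whole space (Husemoller Ch. 17 §1, proof of Thm. 1.1: the comparison maps
of the Leray–Hirsch theorem commute with the Mayer–Vietoris connecting maps).
[cite: HusemollerFibreBundles1994, Ch. 17 §1 Thm. 1.1 (proof)] [cite: HatcherAT2002, §3.2 p. 209] -/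
theorem mvδ_cupRightH (hW : IsOpen W) (hY : IsOpen Y) (h : p + d = n)
    (x : (subsetCochains R 𝑹 (W ∩ Y)).homology p) :
    mvδ R 𝑹 hW hY n ((SimplexSpan.ofSet (R := R) (W ∩ Y)).cupRightH
        (SimplexSpan.frontBackClosed_ofSet _) β hβ h x) =
      (SimplexSpan.ofSet (R := R) (W ∪ Y)).cupRightH (SimplexSpan.frontBackClosed_ofSet _) β hβ
        (show (p + 1) + d = n + 1 by omega) (mvδ R 𝑹 hW hY p x) := by
  obtain ⟨f, hf', rfl⟩ := homologyCls_surjective x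
  -- compare after restricting to small cochains, which is injective on cohomology
  haveI := isIso_homologyMap_resSup (N := 𝑹) hW hY (n + 1)
  apply ((ConcreteCategory.isIso_iff_bijective
    (HomologicalComplex.homologyMap (resSup R 𝑹 W Y) (n + 1))).1 inferInstance).1
  have h1 : (p + 1) + d = n + 1 := by omega
  -- left-hand side: `δ(f ⌣ β)|small = [snakeCochain f ⌣ β]`
  have lhs := (congrArg (fun y ↦ HomologicalComplex.homologyMap (resSup R 𝑹 W Y) (n + 1)
      (mvδ R 𝑹 hW hY n y))
    ((SimplexSpan.ofSet (R := R) (W ∩ Y)).cupRightH_homologyCls (SimplexSpan.frontBackClosed_ofSet _)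
      β hβ h f hf')).trans
    ((homologyMap_resSup_mvδ_eq hW hY n _).trans (shortExact_δ_cls_cupRight β hβ f hf' h))
  -- right-hand side: `(δ f ⌣ β)|small = δ(f)|small ⌣ β = [snakeCochain f] ⌣ β`
  have rhs := ((SimplexSpan.ofSet (R := R) (W ∪ Y)).homologyMap_dualMap_cupRightH
      (SimplexSpan.frontBackClosed_ofSet _) β hβ (SimplexSpan.ofSets (R := R) W Y)
      (chainsInSub_sup_le R R W Y) (SimplexSpan.frontBackClosed_ofSets _ _)
      (fun hσ ↦ hσ.elim (fun h' ↦ h'.trans Set.subset_union_left) fun h' ↦ h'.trans Set.subset_union_right)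
      h1 (mvδ R 𝑹 hW hY p (homologyCls f hf'))).trans
    ((congrArg ((SimplexSpan.ofSets (R := R) W Y).cupRightH (SimplexSpan.frontBackClosed_ofSets _ _) β hβ h1)
      (homologyMap_resSup_mvδ hW hY f hf')).trans
      ((SimplexSpan.ofSets (R := R) W Y).cupRightH_homologyCls (SimplexSpan.frontBackClosed_ofSets _ _)
        β hβ h1 _ _))
  exact lhs.trans rhs.symm

end subsetCochains

end Literature.AlgebraicTopology.SingularHomology
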